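import Summits.HodgeConjecture.HodgeConjecture.Theses.TropicalCuspLift
import Summits.HodgeConjecture.HodgeConjecture.Theses.HeckeOrbitCompactness
import Literature.AlgebraicGeometry.HodgeTheory.WeilClasses
import Literature.AlgebraicGeometry.HodgeTheory.MiddleDimensionReductionOfHodgeDecomposition
import Literature.AlgebraicGeometry.Motives.HodgeDecompositionIsInternalDischarge
import Literature.AlgebraicGeometry.Motives.AbelianVarietyProjectiveChart

/-!
# Route TropicalCuspLift — `Assembly` (stmt-HodgeConjecture-2528): exact logical status of the frame

Item stmt-HodgeConjecture-2528 is `TropicalCuspLift.Assembly := X → HodgeConjecture` with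
`X = TropicalCuspLift.WeilClassesAlgebraic` (Weil classes on abelian `2n`-folds of Weil type
`(A, φ² = -d)`, `n ≥ 2`, are algebraic) inlined verbatim. The route's own docstring calls it the
COMPLEMENT of its scope — the Hodge conjecture for every class that is not such a Weil class — and
"NOT claimed by this line".

This file records, kernel-checked and with no hypothesis beyond the route's declarations and PROVED
theorems of the tree, why the item can be settled in neither direction short of deciding the Clay
problem, and what exactly it is:

* `tropicalCuspLift_assembly_iff` : `Assembly ↔ (WeilClassesAlgebraic → HodgeConjecture)` (`Iff.rfl`);
* `tropicalCuspLift_assembly_iff_heckeOrbitCompactness_summitOffWeilSector` : the item is, up to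
  `Iff.rfl`, the crux `HeckeOrbitCompactness.SummitOffWeilSector` (stmt-HodgeConjecture-14189) of the
  sibling route — one `Prop`, two ledger items;
* `tropicalCuspLift_assembly_of_hodgeConjecture` : `HC → Assembly` (the frame weakens the summit);
* `tropicalCuspLift_weilClassesAlgebraic_of_hodgeConjecture` : `HC → X` — the antecedent is a special
  case of the conclusion (its own hypothesis `IsSmoothProjective (2n) A.X` feeds `HodgeConjecture`
  verbatim), so the only way to PROVE the frame without proving `HC`, namely refuting `X`, refutes
  `HC` (`tropicalCuspLift_not_hodgeConjecture_of_not_weilClassesAlgebraic`);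
* `tropicalCuspLift_not_assembly_iff` : `¬ Assembly ↔ X ∧ ¬ HC` — a refutation must prove the whole
  Weil sector AND disprove the Hodge conjecture; `tropicalCuspLift_assembly_iff_not_or` :
  `Assembly ↔ ¬ X ∨ HC`; `tropicalCuspLift_hodgeConjecture_iff_weil_and_assembly` : `HC ↔ X ∧ Assembly`
  (the frame is exactly "HC minus the Weil sector");
* `tropicalCuspLift_weilClassesAlgebraic_iff_base_and_step` : `X ↔ WeilFourfoldsBase ∧ WittTowerStep`
  (`Nat.le_induction` one way, specialisation the other), whence
  `tropicalCuspLift_assembly_iff_cruxes_imply_summit` :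
  `Assembly ↔ (WeilFourfoldsBase → WittTowerStep → HodgeConjecture)` — the item IS the canonical
  D-0019 glue "typed cruxes ⇒ summit" of this route, and that glue is conjecture-grade because the
  cruxes cover Weil classes only;
* `tropicalCuspLift_assembly_iff_weilClassesOf` : the same statement over the Literature carrier
  `weilClassesOf A φ n d = E₊ ⊔ E₋` (van Geemen 4.9) and WITHOUT the idle hypothesis
  `IsSmoothProjective (2n) A.X` (a theorem: `AbelianVariety.isSmoothProjective_holds`);
* `tropicalCuspLift_assembly_iff_cyclePart` : since `Nonempty (HodgeModel n X)` is now a THEOREM for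
  smooth projective `X` (`nonempty_hodgeModel_holds` = `nonempty_hodgeModel_of_hodgeDecomposition` fed
  `isInternal_hodgePQ_holds`: Serre GAGA + de Rham + Hodge decomposition, all proved in the tree), the anti-vacuity conjunct of `HodgeConjectureFor` is discharged and the item is
  literally "X ⇒ every rational `(p,p)`-class on every smooth projective complex variety is
  algebraic" — nothing degenerate is left to exploit.

Nothing here asserts a Theses decl; every statement is an implication from `HodgeConjecture`, a
negation, or an equivalence. Prover seat prover-pitem-stmt-HodgeConjecture-2528-0, 2026-08-16.
-/

namespace Summit.HodgeConjecture.HodgeConjecture.Theorems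

open CategoryTheory
open Summit.HodgeConjecture.HodgeConjecture.Theses
open Literature.AlgebraicGeometry.Motives Literature.AlgebraicGeometry.HodgeTheory
open Literature.AlgebraicTopology.SingularHomology

/-- The frame unfolds to `WeilClassesAlgebraic → HodgeConjecture` (the item inlines the target
verbatim). [folklore] -/
theorem tropicalCuspLift_assembly_iff :
    TropicalCuspLift.Assembly ↔ (TropicalCuspLift.WeilClassesAlgebraic → _root_.HodgeConjecture) :=
  Iff.rfl

/-- **One `Prop`, two ledger items**: the frame of route TropicalCuspLift (stmt-HodgeConjecture-2528)
and the last-ranked crux `SummitOffWeilSector` of route HeckeOrbitCompactness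
(stmt-HodgeConjecture-14189) are definitionally the same statement (both routes spell the shared
target `WeilClassesAlgebraic`, stmt-HodgeConjecture-2522, identically). Closing either closes both.
[folklore] -/
theorem tropicalCuspLift_assembly_iff_heckeOrbitCompactness_summitOffWeilSector :
    TropicalCuspLift.Assembly ↔ HeckeOrbitCompactness.SummitOffWeilSector :=
  Iff.rfl

/-- The two routes' copies of the shared target `WeilClassesAlgebraic` (stmt-HodgeConjecture-2522)
are the same `Prop`. [folklore] -/
theorem tropicalCuspLift_weilClassesAlgebraic_iff_heckeOrbitCompactness :
    TropicalCuspLift.WeilClassesAlgebraic ↔ HeckeOrbitCompactness.WeilClassesAlgebraic :=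
  Iff.rfl

/-- `HC → Assembly`: the frame is a weakening of the summit. [folklore] -/
theorem tropicalCuspLift_assembly_of_hodgeConjecture :
    _root_.HodgeConjecture → TropicalCuspLift.Assembly :=
  fun hHC _ ↦ hHC

/-- **The antecedent is a special case of the conclusion**: `HC → WeilClassesAlgebraic`, because the
target carries the hypothesis `IsSmoothProjective (2n) A.X`, under which `HodgeConjecture` applies to
`A.X` verbatim and its cycle part in codimension `n` is the claim; none of the Weil-type hypotheses
(`φ² = -d`, the eigen-decomposition `c = c₁ + c₂`) is used. [folklore] -/
theorem tropicalCuspLift_weilClassesAlgebraic_of_hodgeConjecture :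
    _root_.HodgeConjecture → TropicalCuspLift.WeilClassesAlgebraic := by
  intro hHC n _ d _ A φ _ hsp _ c hrat hhodge _
  exact (hHC hsp).2 n c hrat hhodge

/-- Refuting the Weil sector refutes the Hodge conjecture (contrapositive of
`tropicalCuspLift_weilClassesAlgebraic_of_hodgeConjecture`): the only way to prove the frame other
than proving `HC` is a disproof of `HC`. [folklore] -/
theorem tropicalCuspLift_not_hodgeConjecture_of_not_weilClassesAlgebraic
    (h : ¬ TropicalCuspLift.WeilClassesAlgebraic) : ¬ _root_.HodgeConjecture :=
  fun hHC ↦ h (tropicalCuspLift_weilClassesAlgebraic_of_hodgeConjecture hHC)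

/-- A kill of the frame is a disproof of the Hodge conjecture (contrapositive of
`tropicalCuspLift_assembly_of_hodgeConjecture`). [folklore] -/
theorem tropicalCuspLift_not_hodgeConjecture_of_not_assembly (h : ¬ TropicalCuspLift.Assembly) :
    ¬ _root_.HodgeConjecture :=
  fun hHC ↦ h (tropicalCuspLift_assembly_of_hodgeConjecture hHC)

/-- **The exact content of a refutation of the frame**: `¬ Assembly ↔ WeilClassesAlgebraic ∧ ¬ HC`
(classical `¬ (P → Q) ↔ P ∧ ¬ Q`): any refutation proves every Weil class algebraic AND disproves
the Hodge conjecture. [folklore] -/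
theorem tropicalCuspLift_not_assembly_iff :
    ¬ TropicalCuspLift.Assembly ↔
      TropicalCuspLift.WeilClassesAlgebraic ∧ ¬ _root_.HodgeConjecture :=
  Classical.not_imp

/-- Truth table of the frame: `Assembly ↔ ¬ WeilClassesAlgebraic ∨ HC` — provable only by proving
`HC` or by refuting the Weil sector (which refutes `HC`), refutable only in the world "`HC` fails
but every Weil class is algebraic". [folklore] -/
theorem tropicalCuspLift_assembly_iff_not_or :
    TropicalCuspLift.Assembly ↔ ¬ TropicalCuspLift.WeilClassesAlgebraic ∨ _root_.HodgeConjecture :=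
  imp_iff_not_or

/-- Bookkeeping identity of the frame: `HC ↔ WeilClassesAlgebraic ∧ Assembly` — the declared,
not-claimed item is exactly "the Hodge conjecture minus the route's Weil sector". [folklore] -/
theorem tropicalCuspLift_hodgeConjecture_iff_weil_and_assembly :
    _root_.HodgeConjecture ↔ TropicalCuspLift.WeilClassesAlgebraic ∧ TropicalCuspLift.Assembly :=
  ⟨fun hHC ↦ ⟨tropicalCuspLift_weilClassesAlgebraic_of_hodgeConjecture hHC, fun _ ↦ hHC⟩,
    fun h ↦ h.2 h.1⟩

/-- Once the Weil sector is delivered, the frame IS the summit: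
`WeilClassesAlgebraic → (Assembly ↔ HC)`. [folklore] -/
theorem tropicalCuspLift_assembly_iff_hodgeConjecture (hX : TropicalCuspLift.WeilClassesAlgebraic) :
    TropicalCuspLift.Assembly ↔ _root_.HodgeConjecture :=
  ⟨fun h ↦ h hX, fun hHC _ ↦ hHC⟩

/-- **The target is equivalent to base ∧ step**: `WeilClassesAlgebraic ↔ WeilFourfoldsBase ∧
WittTowerStep` — forwards by specialisation (`n = 2`; the step's conclusion `X(n+1)` is an instance of
`X`, its hypothesis `X(n)` unused), backwards by `Nat.le_induction` (the route's `EngineGlue` /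
`closes`). In particular, given Markman's base, the rank-2 crux `WittTowerStep` is exactly as strong
as the whole target. [folklore] -/
theorem tropicalCuspLift_weilClassesAlgebraic_iff_base_and_step :
    TropicalCuspLift.WeilClassesAlgebraic ↔
      TropicalCuspLift.WeilFourfoldsBase ∧ TropicalCuspLift.WittTowerStep :=
  ⟨fun hX ↦ ⟨hX 2 le_rfl, fun n hn _ ↦ hX (n + 1) (Nat.le_succ_of_le hn)⟩,
    fun h n hn ↦ Nat.le_induction h.1 (fun m hm ih ↦ h.2 m hm ih) n hn⟩

/-- **The frame is the canonical D-0019 glue of this route**: `Assembly ↔ (WeilFourfoldsBase →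
WittTowerStep → HodgeConjecture)` — "the route's typed cruxes imply the summit". The forward
direction is the route's deciding theorem `closes`; the backward direction specialises the target
to the base and the step. So the item is not mis-typed glue: it is the honest statement that Weil
classes (all the cruxes deliver) are not known to carry the rest of the Hodge conjecture.
[folklore] -/
theorem tropicalCuspLift_assembly_iff_cruxes_imply_summit :
    TropicalCuspLift.Assembly ↔
      (TropicalCuspLift.WeilFourfoldsBase → TropicalCuspLift.WittTowerStep →
        _root_.HodgeConjecture) := by
  constructor
  · intro hA hbase hstep
    exact hA (tropicalCuspLift_weilClassesAlgebraic_iff_base_and_step.2 ⟨hbase, hstep⟩)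
  · intro h hX
    have hbs := tropicalCuspLift_weilClassesAlgebraic_iff_base_and_step.1 hX
    exact h hbs.1 hbs.2

/-- **The target over the Literature carrier, idle hypothesis removed**: `WeilClassesAlgebraic` is
equivalent to "for `n ≥ 2`, `d ≥ 1`, every complex abelian `2n`-fold `A` with `φ ≫ φ = -d`, every
rational `(n,n)`-class in the Weil plane `weilClassesOf A φ n d = E₊ ⊔ E₋` (van Geemen 4.9;
`mem_weilClassesOf_iff` is the inlined `∃ c₁ c₂, …`) is algebraic" — the hypothesis
`IsSmoothProjective (2n) A.X` of the filed text being a theorem for abelian varieties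
(`AbelianVariety.isSmoothProjective_holds`, Görtz–Wedhorn II Prop. 27.174).
[cite: vanGeemen1994HodgeAV, 4.9] -/
theorem tropicalCuspLift_weilClassesAlgebraic_iff_weilClassesOf :
    TropicalCuspLift.WeilClassesAlgebraic ↔
      ∀ n : ℕ, 2 ≤ n → ∀ d : ℕ, 0 < d → ∀ (A : AbelianVariety ℂ) (φ : A ⟶ A), A.dim = 2 * n →
        φ ≫ φ = -(d • 𝟙 A) → ∀ c : complexBetti A.X (2 * n), IsRationalClass c →
          IsOfHodgeType (2 * n) A.X (2 * n) n n c → c ∈ weilClassesOf A φ n d →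
            c ∈ algebraicClasses A.X n := by
  constructor
  · intro hX n hn d hd A φ hdim hφ c hrat hhodge hmem
    have hsp : IsSmoothProjective (2 * n) A.X := by
      have h := (AbelianVariety.isSmoothProjective_holds (A := A))
      rw [AbelianVariety.isSmoothProjective, hdim] at h
      exact h
    exact hX n hn d hd A φ hdim hsp hφ c hrat hhodge (mem_weilClassesOf_iff.1 hmem)
  · intro h n hn d hd A φ hdim _ hφ c hrat hhodge hmem
    exact h n hn d hd A φ hdim hφ c hrat hhodge (mem_weilClassesOf_iff.2 hmem)

/-- **The frame over the Literature carrier**: `Assembly ↔ ((Weil classes in weilClassesOf A φ n d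
are algebraic, n ≥ 2, no smoothness hypothesis) → HodgeConjecture)`.
[cite: vanGeemen1994HodgeAV, 4.9] -/
theorem tropicalCuspLift_assembly_iff_weilClassesOf :
    TropicalCuspLift.Assembly ↔
      ((∀ n : ℕ, 2 ≤ n → ∀ d : ℕ, 0 < d → ∀ (A : AbelianVariety ℂ) (φ : A ⟶ A), A.dim = 2 * n →
          φ ≫ φ = -(d • 𝟙 A) → ∀ c : complexBetti A.X (2 * n), IsRationalClass c →
            IsOfHodgeType (2 * n) A.X (2 * n) n n c → c ∈ weilClassesOf A φ n d →
              c ∈ algebraicClasses A.X n) →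
        _root_.HodgeConjecture) := by
  rw [tropicalCuspLift_assembly_iff, tropicalCuspLift_weilClassesAlgebraic_iff_weilClassesOf]

/-- **Nothing degenerate is left in the conclusion**: the anti-vacuity conjunct
`Nonempty (HodgeModel n X)` of `HodgeConjectureFor` is a THEOREM for smooth projective `X`
(`nonempty_hodgeModel_holds`: analytification, de Rham comparison and Hodge decomposition, all proved
in the tree), so the frame is literally "Weil classes algebraic ⇒ every rational `(p,p)`-class on
every smooth projective complex variety is a combination of classes of algebraic cycles" — the cycle
part of Deligne's statement and nothing else. [cite: Deligne2000, §1] -/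
theorem tropicalCuspLift_assembly_iff_cyclePart :
    TropicalCuspLift.Assembly ↔
      (TropicalCuspLift.WeilClassesAlgebraic →
        ∀ ⦃n : ℕ⦄ ⦃X : SchemeOver ℂ⦄, IsSmoothProjective n X →
          ∀ (p : ℕ) (c : complexBetti X (2 * p)), IsRationalClass c →
            IsOfHodgeType n X (2 * p) p p c → c ∈ algebraicClasses X p) := by
  refine imp_congr_right fun _ ↦ forall_congr' fun n ↦ forall_congr' fun X ↦
    forall_congr' fun hX ↦ ?_
  -- `Nonempty (HodgeModel n X)` for smooth projective `X`: the Hodge decomposition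
  -- (`isInternal_hodgePQ_holds`) fed to `nonempty_hodgeModel_of_hodgeDecomposition`
  -- (analytification + de Rham's theorem, proved upstream) — the tree's `nonempty_hodgeModel_holds`.
  exact hodgeConjectureFor_iff_of_isSmoothProjective
    (nonempty_hodgeModel_of_hodgeDecomposition (fun _E _ _ _ _M _ _ _ ↦ isInternal_hodgePQ_holds) n X)
    hX

end Summit.HodgeConjecture.HodgeConjecture.Theorems
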